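import Mathlib
import HarnessLib
import HarnessLib.Audit
import Summits.ValiantsHypothesis.ValiantsHypothesis.Theorems.SoloBlindCoreVertexBoundFix

/-!
# Refutation of the core vertex bound `CoreVertexBoundPos`, and the surviving linear form

`CoreVertexBoundPos` (`SoloBlindCoreVertexBoundFix`) asserted the SHARP bound `#(V ∖ Q) ≤ #D` for the number of
non-generator vertices of a `cone Q`-convex lattice polygon with vertices in the monoid `ℕQ ⊂ ℤ²`, `D` containing
every monoid point strictly outside the polygon.  It is **false**: `not_coreVertexBoundPos`.  The witness
(found by this seat from a structural analysis of the dual line arrangement, then by a targeted exact search):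

* generators `Q = {(5,10), (8,4), (8,9), (14,30), (48,20)}`;
* the nine vertices `V = {(96,40), (56,24), (24,12), (16,13), (13,14), (13,19), (15,30), (19,40), (28,60)}`
  (`= 2d, d+a', 3a', a'+x, a+a', a+x, 3a, a+c, 2c` with `a = (5,10)`, `a' = (8,4)`, `x = (8,9)`, `c = (14,30)`,
  `d = (48,20)`), each a strict vertex of `H = conv V + cone Q` (explicit integer functionals);
* exactly eight monoid points lie outside `H`: `D = {0, a, a', x, 2a, c, 2a', d}`.  That no other monoid point is
  separated is certified finitely: every monoid point is in `D` or of the form `x + c` with `x` in the finite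
  border `X = (D + Q) ∖ D` and `c` in the monoid (`cx_decomp`, an induction over the monoid), and each of the 23
  border points carries an explicit certificate `K·x = n₁w₁ + n₂w₂ + m₁q₁ + m₂q₂` (`wᵢ ∈ V`, `qᵢ ∈ Q`, `n₁+n₂ = K ≥ 1`)
  placing it in `H` (`not_separated_of_cert`).

Mechanism (why all random testing missed it): the two *doubled* generators `a, a'` (`2a, 2a' ∈ D`) are ADJACENT
vertices of `conv D + cone Q`, each contributes the extra vertex `3a`, `3a'`, and the deleted point `x` lies in the
intersection of the two pockets, so that it is hit twice (`a + x` and `a' + x`).  In the dual picture (support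
function along the arc of normals) this is the only way to beat `#D`, and it yields at most one extra vertex per
adjacent doubled pair; iterating it along a chain of doubled generators gives families with `#V = #D + μ`, i.e.
`#V/#D → 4/3`, still linear.  The statement that matters upstream (an `O(t)` bound for the south-west chain of
`Newt(fg+1)`, KPTT arXiv:1308.2286 §5 problem 1, generic `g`) only needs a LINEAR bound, recorded here as the
conjecture `CoreVertexBoundLin` (a `Prop`, not asserted).
-/

namespace Summit.ValiantsHypothesis.ValiantsHypothesis.Theorems

/-- Generators of the counterexample monoid. -/
def cxQ : Finset (ℤ × ℤ) := {(5, 10), (8, 4), (8, 9), (14, 30), (48, 20)}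

/-- The nine vertices of the counterexample polygon. -/
def cxV : Finset (ℤ × ℤ) := {(96, 40), (56, 24), (24, 12), (16, 13), (13, 14), (13, 19), (15, 30), (19, 40), (28, 60)}

/-- The eight monoid points outside the counterexample polygon (the set `D`). -/
def cxD : Finset (ℤ × ℤ) := {(0, 0), (5, 10), (8, 4), (8, 9), (10, 20), (14, 30), (16, 8), (48, 20)}

/-- The border `(D + Q) ∖ D` of the counterexample: 23 points, all inside the polygon. -/
def cxX : Finset (ℤ × ℤ) := {(13, 14), (13, 19), (15, 30), (16, 13), (16, 18), (18, 24), (18, 29), (19, 40), (21, 18), (22, 34), (22, 39), (24, 12), (24, 17), (24, 50), (28, 60), (30, 38), (53, 30), (56, 24), (56, 29), (58, 40), (62, 50), (64, 28), (96, 40)}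

/-- One monoid step from `D` lands in `D` or in the border `X`. -/
theorem cx_step : ∀ y ∈ cxD, ∀ q ∈ cxQ, y + q ∈ cxD ∨ y + q ∈ cxX := by
  decide

/-- Every monoid point is in `D` or is a border point plus a monoid point (induction over the monoid). -/
theorem cx_decomp {z : ℤ × ℤ} (hz : z ∈ AddSubmonoid.closure (↑cxQ : Set (ℤ × ℤ))) :
    ∀ y ∈ cxD, y + z ∈ cxD ∨ ∃ x ∈ cxX, ∃ c ∈ AddSubmonoid.closure (↑cxQ : Set (ℤ × ℤ)), y + z = x + c := by
  induction hz using AddSubmonoid.closure_induction with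
  | mem q hq =>
    intro y hy
    rcases cx_step y hy q (Finset.mem_coe.mp hq) with h | h
    · exact Or.inl h
    · exact Or.inr ⟨y + q, h, 0, AddSubmonoid.zero_mem _, by simp⟩
  | zero => intro y hy; exact Or.inl (by simpa using hy)
  | add z₁ z₂ _ hz₂ ih₁ ih₂ =>
    intro y hy
    rcases ih₁ y hy with h1 | ⟨x, hx, c, hc, e⟩
    · rcases ih₂ (y + z₁) h1 with h2 | ⟨x, hx, c, hc, e⟩
      · exact Or.inl (by rwa [← add_assoc])
      · exact Or.inr ⟨x, hx, c, hc, by rw [← add_assoc, e]⟩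
    · exact Or.inr ⟨x, hx, c + z₂, AddSubmonoid.add_mem _ hc hz₂, by rw [← add_assoc, e, add_assoc]⟩

/-- Certificate lemma: if `y = x + c` with `c` in the monoid and `K·x = n₁w₁ + n₂w₂ + m₁q₁ + m₂q₂` with
`wᵢ ∈ V`, `qᵢ ∈ Q`, `nᵢ, mᵢ ≥ 0`, `n₁ + n₂ = K > 0`, then no functional nonnegative on `Q` puts `y` strictly below
all of `V` (so `y ∈ conv V + cone Q`). -/
theorem not_separated_of_cert {Q V : Finset (ℤ × ℤ)} {y x c w₁ w₂ q₁ q₂ : ℤ × ℤ} (n₁ n₂ m₁ m₂ : ℤ)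
    (hw₁ : w₁ ∈ V) (hw₂ : w₂ ∈ V) (hq₁ : q₁ ∈ Q) (hq₂ : q₂ ∈ Q)
    (hc : c ∈ AddSubmonoid.closure (↑Q : Set (ℤ × ℤ))) (hy : y = x + c)
    (hn₁ : 0 ≤ n₁) (hn₂ : 0 ≤ n₂) (hm₁ : 0 ≤ m₁) (hm₂ : 0 ≤ m₂) (hK : 0 < n₁ + n₂)
    (he1 : (n₁ + n₂) * x.1 = n₁ * w₁.1 + n₂ * w₂.1 + m₁ * q₁.1 + m₂ * q₂.1)
    (he2 : (n₁ + n₂) * x.2 = n₁ * w₁.2 + n₂ * w₂.2 + m₁ * q₁.2 + m₂ * q₂.2) :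
    ¬ ∃ a b : ℤ, (∀ q ∈ Q, 0 ≤ a * q.1 + b * q.2) ∧ ∀ w ∈ V, a * y.1 + b * y.2 < a * w.1 + b * w.2 := by
  rintro ⟨a, b, hQ, hV⟩
  have h1 := hV w₁ hw₁
  have h2 := hV w₂ hw₂
  have hc' := linForm_nonneg_of_mem_closure hQ hc
  have hq1 := hQ q₁ hq₁
  have hq2 := hQ q₂ hq₂
  subst hy
  simp only [Prod.fst_add, Prod.snd_add] at h1 h2
  have key : (n₁ + n₂) * (a * x.1 + b * x.2) = n₁ * (a * w₁.1 + b * w₁.2) + n₂ * (a * w₂.1 + b * w₂.2)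
      + m₁ * (a * q₁.1 + b * q₁.2) + m₂ * (a * q₂.1 + b * q₂.2) := by
    linear_combination a * he1 + b * he2
  have e1 : 0 ≤ n₁ * (a * w₁.1 + b * w₁.2 - (a * x.1 + b * x.2) - 1) := mul_nonneg hn₁ (by linarith)
  have e2 : 0 ≤ n₂ * (a * w₂.1 + b * w₂.2 - (a * x.1 + b * x.2) - 1) := mul_nonneg hn₂ (by linarith)
  have e3 : 0 ≤ m₁ * (a * q₁.1 + b * q₁.2) := mul_nonneg hm₁ hq1
  have e4 : 0 ≤ m₂ * (a * q₂.1 + b * q₂.2) := mul_nonneg hm₂ hq2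
  nlinarith [key, e1, e2, e3, e4, hK]

/-- A point equal to a sum of two monoid points is in the monoid. -/
theorem mem_closure_of_eq_add {Q : Finset (ℤ × ℤ)} {y p q : ℤ × ℤ}
    (hp : p ∈ AddSubmonoid.closure (↑Q : Set (ℤ × ℤ))) (hq : q ∈ AddSubmonoid.closure (↑Q : Set (ℤ × ℤ)))
    (h : y = p + q) : y ∈ AddSubmonoid.closure (↑Q : Set (ℤ × ℤ)) := h ▸ AddSubmonoid.add_mem _ hp hq

/-- Generators are in the monoid. -/
theorem gen_mem_closure {Q : Finset (ℤ × ℤ)} {q : ℤ × ℤ} (hq : q ∈ Q) :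
    q ∈ AddSubmonoid.closure (↑Q : Set (ℤ × ℤ)) := AddSubmonoid.subset_closure (Finset.mem_coe.mpr hq)

/-- The counterexample vertices lie in the monoid. -/
theorem cxV_mem : ∀ v ∈ cxV, v ∈ AddSubmonoid.closure (↑cxQ : Set (ℤ × ℤ)) := by
  intro v hv
  simp only [cxV, Finset.mem_insert, Finset.mem_singleton] at hv
  rcases hv with rfl | rfl | rfl | rfl | rfl | rfl | rfl | rfl | rfl
  · exact mem_closure_of_eq_add (gen_mem_closure (Q := cxQ) (q := (48, 20)) (by decide)) (gen_mem_closure (Q := cxQ) (q := (48, 20)) (by decide)) (by decide)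
  · exact mem_closure_of_eq_add (gen_mem_closure (Q := cxQ) (q := (48, 20)) (by decide)) (gen_mem_closure (Q := cxQ) (q := (8, 4)) (by decide)) (by decide)
  · exact mem_closure_of_eq_add (mem_closure_of_eq_add (y := (16, 8)) (gen_mem_closure (Q := cxQ) (q := (8, 4)) (by decide)) (gen_mem_closure (Q := cxQ) (q := (8, 4)) (by decide)) (by decide)) (gen_mem_closure (Q := cxQ) (q := (8, 4)) (by decide)) (by decide)
  · exact mem_closure_of_eq_add (gen_mem_closure (Q := cxQ) (q := (8, 4)) (by decide)) (gen_mem_closure (Q := cxQ) (q := (8, 9)) (by decide)) (by decide)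
  · exact mem_closure_of_eq_add (gen_mem_closure (Q := cxQ) (q := (5, 10)) (by decide)) (gen_mem_closure (Q := cxQ) (q := (8, 4)) (by decide)) (by decide)
  · exact mem_closure_of_eq_add (gen_mem_closure (Q := cxQ) (q := (5, 10)) (by decide)) (gen_mem_closure (Q := cxQ) (q := (8, 9)) (by decide)) (by decide)
  · exact mem_closure_of_eq_add (mem_closure_of_eq_add (y := (10, 20)) (gen_mem_closure (Q := cxQ) (q := (5, 10)) (by decide)) (gen_mem_closure (Q := cxQ) (q := (5, 10)) (by decide)) (by decide)) (gen_mem_closure (Q := cxQ) (q := (5, 10)) (by decide)) (by decide)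
  · exact mem_closure_of_eq_add (gen_mem_closure (Q := cxQ) (q := (5, 10)) (by decide)) (gen_mem_closure (Q := cxQ) (q := (14, 30)) (by decide)) (by decide)
  · exact mem_closure_of_eq_add (gen_mem_closure (Q := cxQ) (q := (14, 30)) (by decide)) (gen_mem_closure (Q := cxQ) (q := (14, 30)) (by decide)) (by decide)

/-- Each counterexample vertex is a strict vertex (integer functional positive on `Q`, uniquely minimised over `V`). -/
theorem cxV_vert : ∀ v ∈ cxV, ∃ a b : ℤ, (∀ q ∈ cxQ, 0 < a * q.1 + b * q.2) ∧
    ∀ w ∈ cxV, w ≠ v → a * v.1 + b * v.2 < a * w.1 + b * w.2 := by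
  intro v hv
  simp only [cxV, Finset.mem_insert, Finset.mem_singleton] at hv
  rcases hv with rfl | rfl | rfl | rfl | rfl | rfl | rfl | rfl | rfl
  · exact ⟨-9, 22, by decide, by decide⟩
  · exact ⟨-7, 18, by decide, by decide⟩
  · exact ⟨-3, 16, by decide, by decide⟩
  · exact ⟨2, 11, by decide, by decide⟩
  · exact ⟨2, 1, by decide, by decide⟩
  · exact ⟨8, -1, by decide, by decide⟩
  · exact ⟨7, -2, by decide, by decide⟩
  · exact ⟨30, -13, by decide, by decide⟩
  · exact ⟨50, -23, by decide, by decide⟩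

/-- Every monoid point separated from `V` is one of the eight points of `D`. -/
theorem cx_sep_mem : ∀ y ∈ AddSubmonoid.closure (↑cxQ : Set (ℤ × ℤ)),
    (∃ a b : ℤ, (∀ q ∈ cxQ, 0 ≤ a * q.1 + b * q.2) ∧ ∀ w ∈ cxV, a * y.1 + b * y.2 < a * w.1 + b * w.2) →
      y ∈ cxD := by
  intro y hy hsep
  rcases cx_decomp hy 0 (by decide) with h | ⟨x, hx, c, hc, e⟩
  · simpa using h
  · exfalso
    rw [zero_add] at e
    simp only [cxX, Finset.mem_insert, Finset.mem_singleton] at hx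
    rcases hx with rfl | rfl | rfl | rfl | rfl | rfl | rfl | rfl | rfl | rfl | rfl | rfl | rfl | rfl | rfl | rfl | rfl | rfl | rfl | rfl | rfl | rfl | rfl
    · exact not_separated_of_cert (V := cxV) (Q := cxQ) (w₁ := (96, 40)) (w₂ := (13, 14)) (q₁ := (5, 10)) (q₂ := (5, 10))
        0 1 0 0 (by decide) (by decide) (by decide) (by decide) hc e
        (by decide) (by decide) (by decide) (by decide) (by decide) (by decide) (by decide) hsep
    · exact not_separated_of_cert (V := cxV) (Q := cxQ) (w₁ := (96, 40)) (w₂ := (13, 19)) (q₁ := (5, 10)) (q₂ := (5, 10))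
        0 1 0 0 (by decide) (by decide) (by decide) (by decide) hc e
        (by decide) (by decide) (by decide) (by decide) (by decide) (by decide) (by decide) hsep
    · exact not_separated_of_cert (V := cxV) (Q := cxQ) (w₁ := (96, 40)) (w₂ := (15, 30)) (q₁ := (5, 10)) (q₂ := (5, 10))
        0 1 0 0 (by decide) (by decide) (by decide) (by decide) hc e
        (by decide) (by decide) (by decide) (by decide) (by decide) (by decide) (by decide) hsep
    · exact not_separated_of_cert (V := cxV) (Q := cxQ) (w₁ := (96, 40)) (w₂ := (16, 13)) (q₁ := (5, 10)) (q₂ := (5, 10))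
        0 1 0 0 (by decide) (by decide) (by decide) (by decide) hc e
        (by decide) (by decide) (by decide) (by decide) (by decide) (by decide) (by decide) hsep
    · exact not_separated_of_cert (V := cxV) (Q := cxQ) (w₁ := (96, 40)) (w₂ := (13, 14)) (q₁ := (5, 10)) (q₂ := (8, 4))
        0 6 2 1 (by decide) (by decide) (by decide) (by decide) hc e
        (by decide) (by decide) (by decide) (by decide) (by decide) (by decide) (by decide) hsep
    · exact not_separated_of_cert (V := cxV) (Q := cxQ) (w₁ := (96, 40)) (w₂ := (13, 14)) (q₁ := (5, 10)) (q₂ := (5, 10))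
        0 1 1 0 (by decide) (by decide) (by decide) (by decide) hc e
        (by decide) (by decide) (by decide) (by decide) (by decide) (by decide) (by decide) hsep
    · exact not_separated_of_cert (V := cxV) (Q := cxQ) (w₁ := (96, 40)) (w₂ := (13, 19)) (q₁ := (5, 10)) (q₂ := (5, 10))
        0 1 1 0 (by decide) (by decide) (by decide) (by decide) hc e
        (by decide) (by decide) (by decide) (by decide) (by decide) (by decide) (by decide) hsep
    · exact not_separated_of_cert (V := cxV) (Q := cxQ) (w₁ := (96, 40)) (w₂ := (19, 40)) (q₁ := (5, 10)) (q₂ := (5, 10))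
        0 1 0 0 (by decide) (by decide) (by decide) (by decide) hc e
        (by decide) (by decide) (by decide) (by decide) (by decide) (by decide) (by decide) hsep
    · exact not_separated_of_cert (V := cxV) (Q := cxQ) (w₁ := (96, 40)) (w₂ := (13, 14)) (q₁ := (5, 10)) (q₂ := (8, 4))
        0 1 0 1 (by decide) (by decide) (by decide) (by decide) hc e
        (by decide) (by decide) (by decide) (by decide) (by decide) (by decide) (by decide) hsep
    · exact not_separated_of_cert (V := cxV) (Q := cxQ) (w₁ := (24, 12)) (w₂ := (15, 30)) (q₁ := (5, 10)) (q₂ := (8, 9))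
        1 4 2 2 (by decide) (by decide) (by decide) (by decide) hc e
        (by decide) (by decide) (by decide) (by decide) (by decide) (by decide) (by decide) hsep
    · exact not_separated_of_cert (V := cxV) (Q := cxQ) (w₁ := (24, 12)) (w₂ := (15, 30)) (q₁ := (5, 10)) (q₂ := (8, 9))
        1 9 9 2 (by decide) (by decide) (by decide) (by decide) hc e
        (by decide) (by decide) (by decide) (by decide) (by decide) (by decide) (by decide) hsep
    · exact not_separated_of_cert (V := cxV) (Q := cxQ) (w₁ := (96, 40)) (w₂ := (24, 12)) (q₁ := (5, 10)) (q₂ := (5, 10))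
        0 1 0 0 (by decide) (by decide) (by decide) (by decide) hc e
        (by decide) (by decide) (by decide) (by decide) (by decide) (by decide) (by decide) hsep
    · exact not_separated_of_cert (V := cxV) (Q := cxQ) (w₁ := (96, 40)) (w₂ := (16, 13)) (q₁ := (5, 10)) (q₂ := (8, 4))
        0 1 0 1 (by decide) (by decide) (by decide) (by decide) hc e
        (by decide) (by decide) (by decide) (by decide) (by decide) (by decide) (by decide) hsep
    · exact not_separated_of_cert (V := cxV) (Q := cxQ) (w₁ := (96, 40)) (w₂ := (19, 40)) (q₁ := (5, 10)) (q₂ := (5, 10))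
        0 1 1 0 (by decide) (by decide) (by decide) (by decide) hc e
        (by decide) (by decide) (by decide) (by decide) (by decide) (by decide) (by decide) hsep
    · exact not_separated_of_cert (V := cxV) (Q := cxQ) (w₁ := (96, 40)) (w₂ := (28, 60)) (q₁ := (5, 10)) (q₂ := (5, 10))
        0 1 0 0 (by decide) (by decide) (by decide) (by decide) hc e
        (by decide) (by decide) (by decide) (by decide) (by decide) (by decide) (by decide) hsep
    · exact not_separated_of_cert (V := cxV) (Q := cxQ) (w₁ := (24, 12)) (w₂ := (28, 60)) (q₁ := (5, 10)) (q₂ := (8, 4))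
        1 1 0 1 (by decide) (by decide) (by decide) (by decide) hc e
        (by decide) (by decide) (by decide) (by decide) (by decide) (by decide) (by decide) hsep
    · exact not_separated_of_cert (V := cxV) (Q := cxQ) (w₁ := (24, 12)) (w₂ := (19, 40)) (q₁ := (8, 9)) (q₂ := (48, 20))
        6 1 2 4 (by decide) (by decide) (by decide) (by decide) hc e
        (by decide) (by decide) (by decide) (by decide) (by decide) (by decide) (by decide) hsep
    · exact not_separated_of_cert (V := cxV) (Q := cxQ) (w₁ := (96, 40)) (w₂ := (56, 24)) (q₁ := (5, 10)) (q₂ := (5, 10))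
        0 1 0 0 (by decide) (by decide) (by decide) (by decide) hc e
        (by decide) (by decide) (by decide) (by decide) (by decide) (by decide) (by decide) hsep
    · exact not_separated_of_cert (V := cxV) (Q := cxQ) (w₁ := (96, 40)) (w₂ := (24, 12)) (q₁ := (8, 4)) (q₂ := (8, 9))
        0 5 19 1 (by decide) (by decide) (by decide) (by decide) hc e
        (by decide) (by decide) (by decide) (by decide) (by decide) (by decide) (by decide) hsep
    · exact not_separated_of_cert (V := cxV) (Q := cxQ) (w₁ := (96, 40)) (w₂ := (15, 30)) (q₁ := (5, 10)) (q₂ := (5, 10))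
        1 1 1 0 (by decide) (by decide) (by decide) (by decide) hc e
        (by decide) (by decide) (by decide) (by decide) (by decide) (by decide) (by decide) hsep
    · exact not_separated_of_cert (V := cxV) (Q := cxQ) (w₁ := (96, 40)) (w₂ := (28, 60)) (q₁ := (5, 10)) (q₂ := (5, 10))
        1 1 0 0 (by decide) (by decide) (by decide) (by decide) hc e
        (by decide) (by decide) (by decide) (by decide) (by decide) (by decide) (by decide) hsep
    · exact not_separated_of_cert (V := cxV) (Q := cxQ) (w₁ := (96, 40)) (w₂ := (56, 24)) (q₁ := (5, 10)) (q₂ := (8, 4))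
        0 1 0 1 (by decide) (by decide) (by decide) (by decide) hc e
        (by decide) (by decide) (by decide) (by decide) (by decide) (by decide) (by decide) hsep
    · exact not_separated_of_cert (V := cxV) (Q := cxQ) (w₁ := (96, 40)) (w₂ := (96, 40)) (q₁ := (5, 10)) (q₂ := (5, 10))
        0 1 0 0 (by decide) (by decide) (by decide) (by decide) hc e
        (by decide) (by decide) (by decide) (by decide) (by decide) (by decide) (by decide) hsep

/-- **`CoreVertexBoundPos` is false.**  `#(V ∖ Q) = 9 > 8 = #D` for the instance above. -/
theorem not_coreVertexBoundPos : ¬ CoreVertexBoundPos := by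
  intro h
  have h98 := h cxQ cxV cxD (by decide) cxV_mem cxV_vert cx_sep_mem
  have h9 : (cxV \ cxQ).card = 9 := by decide
  have h8 : cxD.card = 8 := by decide
  omega

/-- The counterexample in numbers: nine strict non-generator vertices, eight separated monoid points. -/
theorem coreVertexBound_counterexample :
    ∃ Q V D : Finset (ℤ × ℤ), ((0 : ℤ), (0 : ℤ)) ∉ V ∧
      (∀ v ∈ V, v ∈ AddSubmonoid.closure (↑Q : Set (ℤ × ℤ))) ∧
      (∀ v ∈ V, ∃ a b : ℤ, (∀ q ∈ Q, 0 < a * q.1 + b * q.2) ∧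
        ∀ w ∈ V, w ≠ v → a * v.1 + b * v.2 < a * w.1 + b * w.2) ∧
      (∀ y ∈ AddSubmonoid.closure (↑Q : Set (ℤ × ℤ)),
        (∃ a b : ℤ, (∀ q ∈ Q, 0 ≤ a * q.1 + b * q.2) ∧
          ∀ w ∈ V, a * y.1 + b * y.2 < a * w.1 + b * w.2) → y ∈ D) ∧
      (V \ Q).card = D.card + 1 :=
  ⟨cxQ, cxV, cxD, by decide, cxV_mem, cxV_vert, cx_sep_mem, by decide⟩

/-- **Linear core vertex bound** (conjecture; the surviving form after `not_coreVertexBoundPos`).  Same data as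
`CoreVertexBoundPos`, conclusion weakened to a bound linear in `#D` with an absolute constant.  This is what the
generic-`g` reduction of KPTT §5 problem 1 actually needs (any `#(V∖Q) ≤ c·#D` gives `O(t)` south-west vertices of
`Newt(fg+1)`).  Known to this seat: `c = 1` is false (above); families with `#(V∖Q)/#D → 4/3` exist; no instance
with `#(V∖Q) > (4/3)·#D + 2` is known.  CONJECTURAL — a `Prop`, not asserted. -/
@[conjecture] def CoreVertexBoundLin : Prop :=
  ∃ c : ℕ, ∀ (Q V D : Finset (ℤ × ℤ)), ((0 : ℤ), (0 : ℤ)) ∉ V →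
    (∀ v ∈ V, v ∈ AddSubmonoid.closure (↑Q : Set (ℤ × ℤ))) →
    (∀ v ∈ V, ∃ a b : ℤ, (∀ q ∈ Q, 0 < a * q.1 + b * q.2) ∧
        ∀ w ∈ V, w ≠ v → a * v.1 + b * v.2 < a * w.1 + b * w.2) →
    (∀ y ∈ AddSubmonoid.closure (↑Q : Set (ℤ × ℤ)),
        (∃ a b : ℤ, (∀ q ∈ Q, 0 ≤ a * q.1 + b * q.2) ∧
          ∀ w ∈ V, a * y.1 + b * y.2 < a * w.1 + b * w.2) → y ∈ D) →
    (V \ Q).card ≤ c * D.card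

/-- The sharp bound trivially implies the linear one (so the refutation above does not touch `CoreVertexBoundLin`;
recorded only to place the two statements in the tree's implication graph). -/
theorem coreVertexBoundLin_of_pos (h : CoreVertexBoundPos) : CoreVertexBoundLin :=
  ⟨1, fun Q V D h0 hS hV hD => by simpa using h Q V D h0 hS hV hD⟩

end Summit.ValiantsHypothesis.ValiantsHypothesis.Theorems
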